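import Literature.MathematicalPhysics.KineticTheory.BoltzmannSolutionsUkaiDuhamel
import Literature.MathematicalPhysics.KineticTheory.BoltzmannSolutions
import HarnessLib

/-!
# Ukai–Lanford local well-posedness of the hard-sphere Boltzmann equation, III: existence by Picard iteration in the scale `X_{β₀ - λt}`

Helper file (theorems only) for the discharge of the named fact
`Literature.MathematicalPhysics.KineticTheory.ukai_lanford_lwp`: construction of a nonnegative
mild solution of the hard-sphere Boltzmann equation on the torus `T^d` in Lanford's class, for
continuous data `0 ≤ f₀ ≤ K e^{-β₀|v|²/2}`, on a time interval `[0, T]` depending only on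
`(β₀, K, d)` (GST 2013, Part I Ch. 2 §3.1 Thm 1 for the statement; the proof is the one of
Part II Ch. 5 — Ukai's Cauchy–Kovalevskaya-type argument in the scale `X_{β(t)}`,
`β(t) = β₀ - λ t` — specialised to the nonlinear equation, plus an a-posteriori positivity
argument).

* The Picard map is `Φ(F)(t, x, v) = f₀(x - t̂ v, v) + ∫₀^{t̂} Q(F(s, x - (t̂ - s) v, ·))(v) ds`
  with the clamped time `t̂ = max 0 (min t T)` (so that iterates are defined and continuous on all
  of `ℝ × T^d × ℝ^d`); it is written out explicitly in every statement (no definitions).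
* `abs_duhamel_le`: Ukai's estimate for the Duhamel term along characteristics;
  `picard_bound`, `picard_contract`: `Φ` maps the weighted ball
  `|F(t, x, v)| ≤ M e^{-β(t̂)|v|²/2}` into the ball of radius `K + 4 M² S I₀ ρ_T` and contracts
  weighted distances by `4 M S I₀ ρ_T` (`S = |S^{d-1}|`, `I₀ = ∫ (1+|u|) e^{-β₀|u|²/8} du`,
  `ρ_T = T + 2√T/√(2λ)`);
* `exists_fixedPoint_picard`: geometric convergence of the iterates, uniform limit, fixed point;
* `nonneg_of_fixedPoint`: positivity of the fixed point (comparison lemma of part II with the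
  absorption `L(f⁺)`, bootstrapped in the weighted norms);
* `exists_mildSolution`: the existence half of `ukai_lanford_lwp` with an explicit `T(β₀, K, d)`.

## References

* I. Gallagher, L. Saint-Raymond, B. Texier, *From Newton to Boltzmann: hard spheres and
  short-range potentials*, ZLAM, EMS (2013), arXiv:1208.5753: Part I Ch. 2 §3.1 Thm 1; Part II
  Ch. 5 §§1–4 (Thm 7, continuity estimates, Lemma "Ukai").
* S. Ukai, *The Boltzmann–Grad limit and Cauchy–Kovalevskaya theorem*, Japan J. Indust. Appl.
  Math. 18 (2001) 383–392.
-/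

open MeasureTheory Metric Real Set Filter Topology
open scoped InnerProductSpace ENNReal
open Literature.Analysis.FunctionSpaces.Torus (proj proj_add proj_neg proj_zero continuous_proj)

namespace Literature.MathematicalPhysics.KineticTheory

namespace UkaiLanford

noncomputable section

variable {d : Type*} [Fintype d]

/-! ## The clamped time and the torus characteristics -/

section Clamp

/-- The clamped time `t̂ = max 0 (min t T)` satisfies `0 ≤ t̂ ≤ T` (`T ≥ 0`). [folklore] -/
theorem clamp_nonneg_le {T : ℝ} (hT : 0 ≤ T) (t : ℝ) : 0 ≤ max 0 (min t T) ∧ max 0 (min t T) ≤ T :=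
  ⟨le_max_left _ _, max_le hT (min_le_right _ _)⟩

/-- For `0 ≤ t ≤ T` the clamp is the identity. [folklore] -/
theorem clamp_eq_self {T t : ℝ} (h0 : 0 ≤ t) (hT : t ≤ T) : max 0 (min t T) = t := by
  rw [min_eq_left hT, max_eq_right h0]

omit [Fintype d] in
/-- Torus characteristics compose: `(x + t v) + s v = x + (t + s) v` (additivity of the covering
map `Torus.proj`). [folklore] -/
theorem translate_translate (x : UnitAddTorus d) (v : EuclideanSpace ℝ d) (a b : ℝ) :
    x + proj (a • v) + proj (b • v) = x + proj ((a + b) • v) := by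
  rw [add_assoc, ← proj_add, add_smul]

omit [Fintype d] in
/-- `(x + t v) - t v = x` on the torus. [folklore] -/
theorem translate_neg (x : UnitAddTorus d) (v : EuclideanSpace ℝ d) (a : ℝ) :
    x + proj (a • v) + proj (-(a • v)) = x := by
  rw [proj_neg, add_neg_cancel_right]

end Clamp

/-! ## Continuity of the collision terms along a continuous Gaussian-dominated family -/

section Family

/-- Uniform Gaussian bound from the scale bound: `|F| ≤ M e^{-(β₀ - λ t̂)|u|²/2}` with
`λ T ≤ β₀/2`, `λ ≥ 0` gives `|F| ≤ M e^{-(β₀/2)|u|²/2}`. [folklore] -/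
theorem bound_uniform_of_scale {X E' : Type*} [NormedAddCommGroup E'] {F : ℝ → X → E' → ℝ}
    {M β₀ lam T : ℝ} (hlam : 0 ≤ lam) (hT : 0 ≤ T) (hlamT : lam * T ≤ β₀ / 2)
    (hFb : ∀ s x u, |F s x u| ≤ M * exp (-((β₀ - lam * max 0 (min s T)) / 2) * ‖u‖ ^ 2)) :
    ∀ s x u, |F s x u| ≤ M * exp (-(β₀ / 2 / 2) * ‖u‖ ^ 2) := by
  intro s x u
  have hc := clamp_nonneg_le hT s
  have hM : 0 ≤ M * exp (-((β₀ - lam * max 0 (min s T)) / 2) * ‖u‖ ^ 2) := (abs_nonneg _).trans (hFb s x u)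
  rcases eq_or_lt_of_le (exp_pos (-((β₀ - lam * max 0 (min s T)) / 2) * ‖u‖ ^ 2)).le with h | h
  · exact absurd h.symm (exp_pos _).ne'
  have hM0 : 0 ≤ M := nonneg_of_mul_nonneg_left hM h
  refine (hFb s x u).trans (mul_le_mul_of_nonneg_left (exp_weight_mono ?_ ‖u‖) hM0)
  have : lam * max 0 (min s T) ≤ lam * T := mul_le_mul_of_nonneg_left hc.2 hlam
  linarith

/-- Joint continuity of `(s, y, v) ↦ Q(F(s, y, ·))(v)` for a jointly continuous family with a
uniform Gaussian bound. [folklore] -/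
theorem continuous_collisionOp_family {F : ℝ → UnitAddTorus d → EuclideanSpace ℝ d → ℝ}
    (hFc : Continuous fun p : ℝ × UnitAddTorus d × EuclideanSpace ℝ d => F p.1 p.2.1 p.2.2)
    {M β : ℝ} (hM : 0 ≤ M) (hβ : 0 < β)
    (hFb : ∀ s x u, |F s x u| ≤ M * exp (-(β / 2) * ‖u‖ ^ 2)) :
    Continuous fun p : ℝ × UnitAddTorus d × EuclideanSpace ℝ d =>
      collisionOp (F p.1 p.2.1) (F p.1 p.2.1) p.2.2 := by
  have hF' : Continuous fun z : (ℝ × UnitAddTorus d) × EuclideanSpace ℝ d => F z.1.1 z.1.2 z.2 :=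
    hFc.comp (f := fun z : (ℝ × UnitAddTorus d) × EuclideanSpace ℝ d => (z.1.1, z.1.2, z.2)) (by fun_prop)
  have h : Continuous fun z : (ℝ × UnitAddTorus d) × EuclideanSpace ℝ d =>
      collisionOp (F z.1.1 z.1.2) (F z.1.1 z.1.2) z.2 :=
    continuous_collisionOp_param (P := ℝ × UnitAddTorus d) (F := fun p u => F p.1 p.2 u) hF' hM hβ
      (fun p u => hFb p.1 p.2 u)
  have hg : Continuous fun p : ℝ × UnitAddTorus d × EuclideanSpace ℝ d => ((p.1, p.2.1), p.2.2) := by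
    fun_prop
  exact (h.comp' hg :)

/-- Joint continuity of `(s, y, v) ↦ L(F(s, y, ·)⁺)(v)` for a jointly continuous family with a
uniform Gaussian bound. [folklore] -/
theorem continuous_lossPos_family {F : ℝ → UnitAddTorus d → EuclideanSpace ℝ d → ℝ}
    (hFc : Continuous fun p : ℝ × UnitAddTorus d × EuclideanSpace ℝ d => F p.1 p.2.1 p.2.2)
    {M β : ℝ} (hM : 0 ≤ M) (hβ : 0 < β)
    (hFb : ∀ s x u, |F s x u| ≤ M * exp (-(β / 2) * ‖u‖ ^ 2)) :
    Continuous fun p : ℝ × UnitAddTorus d × EuclideanSpace ℝ d =>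
      ∫ w, ∫ ω, hardSphereKernel (p.2.2, w) ω * max (F p.1 p.2.1 w) 0
        ∂(sphereMeasure : Measure (sphere (0 : EuclideanSpace ℝ d) 1)) := by
  have hF' : Continuous fun z : (ℝ × UnitAddTorus d) × EuclideanSpace ℝ d => F z.1.1 z.1.2 z.2 :=
    hFc.comp (f := fun z : (ℝ × UnitAddTorus d) × EuclideanSpace ℝ d => (z.1.1, z.1.2, z.2)) (by fun_prop)
  have h : Continuous fun z : (ℝ × UnitAddTorus d) × EuclideanSpace ℝ d =>
      ∫ w, ∫ ω, hardSphereKernel (z.2, w) ω * max (F z.1.1 z.1.2 w) 0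
        ∂(sphereMeasure : Measure (sphere (0 : EuclideanSpace ℝ d) 1)) :=
    continuous_lossPos_param (P := ℝ × UnitAddTorus d) (F := fun p u => F p.1 p.2 u) hF' hM hβ
      (fun p u => hFb p.1 p.2 u)
  have hg : Continuous fun p : ℝ × UnitAddTorus d × EuclideanSpace ℝ d => ((p.1, p.2.1), p.2.2) := by
    fun_prop
  exact (h.comp' hg :)

/-- **Continuity of the Picard map.** If `f₀` and the collision term
`(s, y, v) ↦ Q(F(s, y, ·))(v)` are jointly continuous, then so is
`(t, x, v) ↦ f₀(x - t̂ v, v) + ∫₀^{t̂} Q(F(s, x - (t̂ - s) v, ·))(v) ds`, `t̂ = max 0 (min t T)`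
(parametric interval integrals with continuous integrand and continuous upper limit). [folklore] -/
theorem continuous_picard {F : ℝ → UnitAddTorus d → EuclideanSpace ℝ d → ℝ}
    {f₀ : UnitAddTorus d → EuclideanSpace ℝ d → ℝ} (hf₀ : Continuous (Function.uncurry f₀))
    (hQc : Continuous fun p : ℝ × UnitAddTorus d × EuclideanSpace ℝ d =>
      collisionOp (F p.1 p.2.1) (F p.1 p.2.1) p.2.2) (T : ℝ) :
    Continuous fun p : ℝ × UnitAddTorus d × EuclideanSpace ℝ d =>
      f₀ (p.2.1 + proj (-(max 0 (min p.1 T) • p.2.2))) p.2.2 +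
        ∫ s in (0 : ℝ)..max 0 (min p.1 T),
          collisionOp (F s (p.2.1 + proj ((s - max 0 (min p.1 T)) • p.2.2)))
            (F s (p.2.1 + proj ((s - max 0 (min p.1 T)) • p.2.2))) p.2.2 := by
  have hc : Continuous fun t : ℝ => max 0 (min t T) := (continuous_const.max (continuous_id.min continuous_const) :
      Continuous fun t : ℝ => max 0 (min t T))
  have hproj := continuous_proj (d := d)
  -- the free-transport term
  have h1 : Continuous fun p : ℝ × UnitAddTorus d × EuclideanSpace ℝ d =>
      (p.2.1 + proj (-(max 0 (min p.1 T) • p.2.2)), p.2.2) := by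
    refine Continuous.prodMk ?_ (by fun_prop)
    have hs : Continuous fun p : ℝ × UnitAddTorus d × EuclideanSpace ℝ d =>
        -(max 0 (min p.1 T) • p.2.2) := ((hc.comp continuous_fst).smul continuous_snd.snd).neg
    exact continuous_snd.fst.add (hproj.comp hs)
  have hfree : Continuous fun p : ℝ × UnitAddTorus d × EuclideanSpace ℝ d =>
      f₀ (p.2.1 + proj (-(max 0 (min p.1 T) • p.2.2))) p.2.2 := hf₀.comp h1
  -- the Duhamel term
  have hinner : Continuous fun q : (ℝ × UnitAddTorus d × EuclideanSpace ℝ d) × ℝ =>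
      (q.2, q.1.2.1 + proj ((q.2 - max 0 (min q.1.1 T)) • q.1.2.2), q.1.2.2) := by
    refine Continuous.prodMk (by fun_prop) (Continuous.prodMk ?_ (by fun_prop))
    have hs : Continuous fun q : (ℝ × UnitAddTorus d × EuclideanSpace ℝ d) × ℝ =>
        (q.2 - max 0 (min q.1.1 T)) • q.1.2.2 :=
      (continuous_snd.sub (hc.comp continuous_fst.fst)).smul continuous_fst.snd.snd
    exact continuous_fst.snd.fst.add (hproj.comp hs)
  have hQi := hQc.comp' hinner
  have hint := intervalIntegral.continuous_parametric_intervalIntegral_of_continuous (μ := volume)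
    (a₀ := 0) (f := fun (p : ℝ × UnitAddTorus d × EuclideanSpace ℝ d) (s : ℝ) =>
      collisionOp (F s (p.2.1 + proj ((s - max 0 (min p.1 T)) • p.2.2)))
        (F s (p.2.1 + proj ((s - max 0 (min p.1 T)) • p.2.2))) p.2.2)
    hQi (hc.comp continuous_fst)
  exact hfree.add hint

/-- **Ukai's estimate for the Duhamel term along torus characteristics**: if
`|Q(s, y, v)| ≤ A (1 + |v|) e^{-(β₀ - λ s)|v|²/2}` for `s ∈ [0, T]`, then for every `t`,
`|∫₀^{t̂} Q(s, x - (t̂ - s) v, v) ds| ≤ A ρ_T e^{-(β₀ - λ t̂)|v|²/2}`, `ρ_T = T + 2√T/√(2λ)`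
(`abs_integral_le_of_scale` on `[0, t̂]`). [cite: GST2013, Part II Ch. 5 §3 (Lemma of Ukai)] -/
theorem abs_duhamel_le {Qd : ℝ → UnitAddTorus d → EuclideanSpace ℝ d → ℝ} {A β₀ lam T : ℝ}
    (hA : 0 ≤ A) (hlam : 0 < lam) (hT : 0 ≤ T)
    (hQ : ∀ s ∈ Icc 0 T, ∀ y v, |Qd s y v| ≤
      A * ((1 + ‖v‖) * exp (-((β₀ - lam * s) / 2) * ‖v‖ ^ 2)))
    (t : ℝ) (x : UnitAddTorus d) (v : EuclideanSpace ℝ d) :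
    |∫ s in (0 : ℝ)..max 0 (min t T), Qd s (x + proj ((s - max 0 (min t T)) • v)) v| ≤
      A * (T + 2 * sqrt T / sqrt (2 * lam)) *
        exp (-((β₀ - lam * max 0 (min t T)) / 2) * ‖v‖ ^ 2) := by
  set τ := max 0 (min t T) with hτdef
  have hτ : τ ∈ Icc 0 T := clamp_nonneg_le hT t
  have h := abs_integral_le_of_scale (q := fun s => Qd s (x + proj ((s - τ) • v)) v) (A := A)
    (lam := lam) (β₁ := β₀) (t₁ := 0) (t := τ) (r := ‖v‖) hA hlam hτ.1 (fun s hs => by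
      have := hQ s ⟨hs.1.le, hs.2.le.trans hτ.2⟩ (x + proj ((s - τ) • v)) v
      simpa only [sub_zero] using this)
  simp only [sub_zero] at h
  refine h.trans ?_
  have hsq : sqrt τ ≤ sqrt T := sqrt_le_sqrt hτ.2
  have hρ : τ + 2 * sqrt τ / sqrt (2 * lam) ≤ T + 2 * sqrt T / sqrt (2 * lam) := by
    have : 2 * sqrt τ / sqrt (2 * lam) ≤ 2 * sqrt T / sqrt (2 * lam) :=
      div_le_div_of_nonneg_right (by linarith) (sqrt_nonneg _)
    linarith [hτ.2]
  calc A * exp (-((β₀ - lam * τ) / 2) * ‖v‖ ^ 2) * (τ + 2 * sqrt τ / sqrt (2 * lam))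
      ≤ A * exp (-((β₀ - lam * τ) / 2) * ‖v‖ ^ 2) * (T + 2 * sqrt T / sqrt (2 * lam)) :=
        mul_le_mul_of_nonneg_left hρ (mul_nonneg hA (exp_pos _).le)
    _ = A * (T + 2 * sqrt T / sqrt (2 * lam)) * exp (-((β₀ - lam * τ) / 2) * ‖v‖ ^ 2) := by ring

end Family

/-! ## The Picard map on the weighted ball: bound and contraction -/

section Picard

/-- **The Picard map preserves the weighted ball** (GST 2013 Part II Ch. 5, proof of Thm 7:
`|||F||| ≤ 2 ‖F(0)‖` when the Duhamel term has norm `≤ 1/2`): if `|f₀| ≤ K e^{-β₀|v|²/2}` and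
`|F(s, x, u)| ≤ M e^{-(β₀ - λ ŝ)|u|²/2}`, then
`|Φ(F)(t, x, v)| ≤ (K + 4 M² S I₀ ρ_T) e^{-(β₀ - λ t̂)|v|²/2}` with `S = |S^{d-1}|`,
`I₀ = ∫ (1 + |u|) e^{-β₀|u|²/8} du`, `ρ_T = T + 2√T/√(2λ)` (`λ T ≤ β₀/2`). [cite: GST2013, Part II Ch. 5 §3] -/
theorem picard_bound {F : ℝ → UnitAddTorus d → EuclideanSpace ℝ d → ℝ}
    {f₀ : UnitAddTorus d → EuclideanSpace ℝ d → ℝ} {K M β₀ lam T : ℝ}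
    (hK : 0 ≤ K) (hM : 0 ≤ M) (hβ₀ : 0 < β₀) (hlam : 0 < lam) (hT : 0 ≤ T) (hlamT : lam * T ≤ β₀ / 2)
    (hf₀b : ∀ x v, |f₀ x v| ≤ K * exp (-(β₀ / 2) * ‖v‖ ^ 2))
    (hFc : Continuous fun p : ℝ × UnitAddTorus d × EuclideanSpace ℝ d => F p.1 p.2.1 p.2.2)
    (hFb : ∀ s x u, |F s x u| ≤ M * exp (-((β₀ - lam * max 0 (min s T)) / 2) * ‖u‖ ^ 2))
    (t : ℝ) (x : UnitAddTorus d) (v : EuclideanSpace ℝ d) :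
    |f₀ (x + proj (-(max 0 (min t T) • v))) v +
        ∫ s in (0 : ℝ)..max 0 (min t T),
          collisionOp (F s (x + proj ((s - max 0 (min t T)) • v)))
            (F s (x + proj ((s - max 0 (min t T)) • v))) v| ≤
      (K + 4 * M * M * (sphereMeasure : Measure (sphere (0 : EuclideanSpace ℝ d) 1)).real univ *
          (∫ u : EuclideanSpace ℝ d, (1 + ‖u‖) * exp (-(β₀ / 2 / 2) * ‖u‖ ^ 2)) *
          (T + 2 * sqrt T / sqrt (2 * lam))) *
        exp (-((β₀ - lam * max 0 (min t T)) / 2) * ‖v‖ ^ 2) := by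
  set S : ℝ := (sphereMeasure : Measure (sphere (0 : EuclideanSpace ℝ d) 1)).real univ with hS
  set I₀ : ℝ := ∫ u : EuclideanSpace ℝ d, (1 + ‖u‖) * exp (-(β₀ / 2 / 2) * ‖u‖ ^ 2) with hI₀
  set ρ : ℝ := T + 2 * sqrt T / sqrt (2 * lam) with hρ
  set τ := max 0 (min t T) with hτdef
  have hτ : τ ∈ Icc 0 T := clamp_nonneg_le hT t
  have hS0 : 0 ≤ S := measureReal_nonneg
  have hI0 : 0 ≤ I₀ := integral_one_add_norm_mul_exp_nonneg _
  -- the free-transport term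
  have hfree : |f₀ (x + proj (-(τ • v))) v| ≤ K * exp (-((β₀ - lam * τ) / 2) * ‖v‖ ^ 2) := by
    refine (hf₀b _ v).trans (mul_le_mul_of_nonneg_left (exp_weight_mono ?_ ‖v‖) hK)
    nlinarith [hτ.1, hlam.le]
  -- the Duhamel term
  have hQ : ∀ s ∈ Icc 0 T, ∀ y w, |collisionOp (F s y) (F s y) w| ≤
      (4 * M * M * S * I₀) * ((1 + ‖w‖) * exp (-((β₀ - lam * s) / 2) * ‖w‖ ^ 2)) := by
    intro s hs y w
    have hcs : max 0 (min s T) = s := clamp_eq_self hs.1 hs.2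
    have hβs : 0 < β₀ - lam * s := by nlinarith [hs.2, hlam.le]
    have hβs' : β₀ / 2 ≤ β₀ - lam * s := by nlinarith [hs.2, hlam.le]
    have hgc : Continuous (F s y) :=
      hFc.comp (by fun_prop : Continuous fun u : EuclideanSpace ℝ d => (s, y, u))
    have hgb : ∀ u, |F s y u| ≤ M * exp (-((β₀ - lam * s) / 2) * ‖u‖ ^ 2) := fun u => by
      have := hFb s y u; rwa [hcs] at this
    have h := abs_collisionOp_le hgc hM hβs hgb w
    have hI : ∫ u : EuclideanSpace ℝ d, (1 + ‖u‖) * exp (-((β₀ - lam * s) / 2) * ‖u‖ ^ 2) ≤ I₀ :=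
      integral_one_add_norm_mul_exp_mono (half_pos hβ₀) hβs'
    refine h.trans ?_
    have hψ0 : 0 ≤ (1 + ‖w‖) * exp (-((β₀ - lam * s) / 2) * ‖w‖ ^ 2) := by positivity
    have : 4 * M * M * S * (∫ u : EuclideanSpace ℝ d, (1 + ‖u‖) * exp (-((β₀ - lam * s) / 2) * ‖u‖ ^ 2)) ≤
        4 * M * M * S * I₀ := mul_le_mul_of_nonneg_left hI (by positivity)
    exact mul_le_mul_of_nonneg_right this hψ0
  have hduh := abs_duhamel_le (Qd := fun s y w => collisionOp (F s y) (F s y) w)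
    (by positivity : 0 ≤ 4 * M * M * S * I₀) hlam hT hQ t x v
  -- combine
  refine (abs_add_le _ _).trans ?_
  have := add_le_add hfree hduh
  refine this.trans (le_of_eq ?_)
  ring

/-- **The Picard map contracts weighted distances** (GST 2013 Part II Ch. 5 §3: the Duhamel
operator has norm `< 1` in `X_{0,β,μ}` for `T` small): if `|F|, |G| ≤ M e^{-(β₀ - λ ŝ)|u|²/2}` and
`|F - G| ≤ N e^{-(β₀ - λ ŝ)|u|²/2}`, then
`|Φ(F)(t,x,v) - Φ(G)(t,x,v)| ≤ (4 M S I₀ ρ_T) N e^{-(β₀ - λ t̂)|v|²/2}`. [cite: GST2013, Part II Ch. 5 §3] -/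
theorem picard_contract {F G : ℝ → UnitAddTorus d → EuclideanSpace ℝ d → ℝ}
    {f₀ : UnitAddTorus d → EuclideanSpace ℝ d → ℝ} {M N β₀ lam T : ℝ}
    (hM : 0 ≤ M) (hN : 0 ≤ N) (hβ₀ : 0 < β₀) (hlam : 0 < lam) (hT : 0 ≤ T) (hlamT : lam * T ≤ β₀ / 2)
    (hFc : Continuous fun p : ℝ × UnitAddTorus d × EuclideanSpace ℝ d => F p.1 p.2.1 p.2.2)
    (hGc : Continuous fun p : ℝ × UnitAddTorus d × EuclideanSpace ℝ d => G p.1 p.2.1 p.2.2)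
    (hFb : ∀ s x u, |F s x u| ≤ M * exp (-((β₀ - lam * max 0 (min s T)) / 2) * ‖u‖ ^ 2))
    (hGb : ∀ s x u, |G s x u| ≤ M * exp (-((β₀ - lam * max 0 (min s T)) / 2) * ‖u‖ ^ 2))
    (hFG : ∀ s x u, |F s x u - G s x u| ≤ N * exp (-((β₀ - lam * max 0 (min s T)) / 2) * ‖u‖ ^ 2))
    (t : ℝ) (x : UnitAddTorus d) (v : EuclideanSpace ℝ d) :
    |(f₀ (x + proj (-(max 0 (min t T) • v))) v +
        ∫ s in (0 : ℝ)..max 0 (min t T),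
          collisionOp (F s (x + proj ((s - max 0 (min t T)) • v)))
            (F s (x + proj ((s - max 0 (min t T)) • v))) v) -
      (f₀ (x + proj (-(max 0 (min t T) • v))) v +
        ∫ s in (0 : ℝ)..max 0 (min t T),
          collisionOp (G s (x + proj ((s - max 0 (min t T)) • v)))
            (G s (x + proj ((s - max 0 (min t T)) • v))) v)| ≤
      (4 * M * (sphereMeasure : Measure (sphere (0 : EuclideanSpace ℝ d) 1)).real univ *
          (∫ u : EuclideanSpace ℝ d, (1 + ‖u‖) * exp (-(β₀ / 2 / 2) * ‖u‖ ^ 2)) *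
          (T + 2 * sqrt T / sqrt (2 * lam))) * N *
        exp (-((β₀ - lam * max 0 (min t T)) / 2) * ‖v‖ ^ 2) := by
  set S : ℝ := (sphereMeasure : Measure (sphere (0 : EuclideanSpace ℝ d) 1)).real univ with hS
  set I₀ : ℝ := ∫ u : EuclideanSpace ℝ d, (1 + ‖u‖) * exp (-(β₀ / 2 / 2) * ‖u‖ ^ 2) with hI₀
  set ρ : ℝ := T + 2 * sqrt T / sqrt (2 * lam) with hρ
  set τ := max 0 (min t T) with hτdef
  have hτ : τ ∈ Icc 0 T := clamp_nonneg_le hT t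
  have hS0 : 0 ≤ S := measureReal_nonneg
  have hI0 : 0 ≤ I₀ := integral_one_add_norm_mul_exp_nonneg _
  -- continuity of the two collision terms along the characteristic (for `integral_sub`)
  have hβ2 : 0 < β₀ / 2 := half_pos hβ₀
  have hFu := bound_uniform_of_scale hlam.le hT hlamT hFb
  have hGu := bound_uniform_of_scale hlam.le hT hlamT hGb
  have hQFc := continuous_collisionOp_family hFc hM hβ2 hFu
  have hQGc := continuous_collisionOp_family hGc hM hβ2 hGu
  have hpath : Continuous fun s : ℝ => (s, x + proj ((s - τ) • v), v) := by
    refine Continuous.prodMk continuous_id (Continuous.prodMk ?_ continuous_const)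
    exact continuous_const.add ((continuous_proj (d := d)).comp ((continuous_id.sub continuous_const).smul continuous_const))
  have hiF : IntervalIntegrable (fun s => collisionOp (F s (x + proj ((s - τ) • v)))
      (F s (x + proj ((s - τ) • v))) v) volume 0 τ := (hQFc.comp' hpath).intervalIntegrable 0 τ
  have hiG : IntervalIntegrable (fun s => collisionOp (G s (x + proj ((s - τ) • v)))
      (G s (x + proj ((s - τ) • v))) v) volume 0 τ := (hQGc.comp' hpath).intervalIntegrable 0 τ
  -- pointwise difference bound
  have hQ : ∀ s ∈ Icc 0 T, ∀ y w, |collisionOp (F s y) (F s y) w - collisionOp (G s y) (G s y) w| ≤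
      (4 * M * N * S * I₀) * ((1 + ‖w‖) * exp (-((β₀ - lam * s) / 2) * ‖w‖ ^ 2)) := by
    intro s hs y w
    have hcs : max 0 (min s T) = s := clamp_eq_self hs.1 hs.2
    have hβs : 0 < β₀ - lam * s := by nlinarith [hs.2, hlam.le]
    have hβs' : β₀ / 2 ≤ β₀ - lam * s := by nlinarith [hs.2, hlam.le]
    have hfc' : Continuous (F s y) :=
      hFc.comp (by fun_prop : Continuous fun u : EuclideanSpace ℝ d => (s, y, u))
    have hgc' : Continuous (G s y) :=
      hGc.comp (by fun_prop : Continuous fun u : EuclideanSpace ℝ d => (s, y, u))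
    have hfb' : ∀ u, |F s y u| ≤ M * exp (-((β₀ - lam * s) / 2) * ‖u‖ ^ 2) := fun u => by
      have := hFb s y u; rwa [hcs] at this
    have hgb' : ∀ u, |G s y u| ≤ M * exp (-((β₀ - lam * s) / 2) * ‖u‖ ^ 2) := fun u => by
      have := hGb s y u; rwa [hcs] at this
    have hfg' : ∀ u, |F s y u - G s y u| ≤ N * exp (-((β₀ - lam * s) / 2) * ‖u‖ ^ 2) := fun u => by
      have := hFG s y u; rwa [hcs] at this
    have h := abs_collisionOp_sub_le hfc' hgc' hM hN hβs hfb' hgb' hfg' w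
    have hI : ∫ u : EuclideanSpace ℝ d, (1 + ‖u‖) * exp (-((β₀ - lam * s) / 2) * ‖u‖ ^ 2) ≤ I₀ :=
      integral_one_add_norm_mul_exp_mono (half_pos hβ₀) hβs'
    refine h.trans ?_
    have hψ0 : 0 ≤ (1 + ‖w‖) * exp (-((β₀ - lam * s) / 2) * ‖w‖ ^ 2) := by positivity
    have : 4 * M * N * S * (∫ u : EuclideanSpace ℝ d, (1 + ‖u‖) * exp (-((β₀ - lam * s) / 2) * ‖u‖ ^ 2)) ≤
        4 * M * N * S * I₀ := mul_le_mul_of_nonneg_left hI (by positivity)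
    exact mul_le_mul_of_nonneg_right this hψ0
  have hduh := abs_duhamel_le
    (Qd := fun s y w => collisionOp (F s y) (F s y) w - collisionOp (G s y) (G s y) w)
    (by positivity : 0 ≤ 4 * M * N * S * I₀) hlam hT hQ t x v
  rw [add_sub_add_left_eq_sub, ← intervalIntegral.integral_sub hiF hiG]
  refine hduh.trans (le_of_eq ?_)
  ring

end Picard

/-! ## Picard iteration: geometric convergence and the fixed point -/

section FixedPoint

/-- **The Picard iterates stay in the ball and converge geometrically**: with
`F₀ = 0`, `F_{n+1} = Φ(F_n)`, the smallness `K + 4 M² S I₀ ρ_T ≤ M` gives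
`|F_n| ≤ M e^{-(β₀-λt̂)|v|²/2}`, joint continuity of every iterate, and
`|F_{n+1} - F_n| ≤ M θⁿ e^{-(β₀-λt̂)|v|²/2}` with `θ = 4 M S I₀ ρ_T`
(GST 2013 Part II Ch. 5 §2, the Neumann/Picard series). [cite: GST2013, Part II Ch. 5 §2] -/
theorem picard_iterates {Fs : ℕ → ℝ → UnitAddTorus d → EuclideanSpace ℝ d → ℝ}
    {f₀ : UnitAddTorus d → EuclideanSpace ℝ d → ℝ} {K M β₀ lam T : ℝ}
    (hK : 0 ≤ K) (hM : 0 ≤ M) (hβ₀ : 0 < β₀) (hlam : 0 < lam) (hT : 0 ≤ T) (hlamT : lam * T ≤ β₀ / 2)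
    (hf₀c : Continuous (Function.uncurry f₀))
    (hf₀b : ∀ x v, |f₀ x v| ≤ K * exp (-(β₀ / 2) * ‖v‖ ^ 2))
    (hball : K + 4 * M * M * (sphereMeasure : Measure (sphere (0 : EuclideanSpace ℝ d) 1)).real univ *
          (∫ u : EuclideanSpace ℝ d, (1 + ‖u‖) * exp (-(β₀ / 2 / 2) * ‖u‖ ^ 2)) *
          (T + 2 * sqrt T / sqrt (2 * lam)) ≤ M)
    (h0 : ∀ t x v, Fs 0 t x v = 0)
    (hsucc : ∀ n t x v, Fs (n + 1) t x v =
      f₀ (x + proj (-(max 0 (min t T) • v))) v +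
        ∫ s in (0 : ℝ)..max 0 (min t T),
          collisionOp (Fs n s (x + proj ((s - max 0 (min t T)) • v)))
            (Fs n s (x + proj ((s - max 0 (min t T)) • v))) v) :
    (∀ n, Continuous fun p : ℝ × UnitAddTorus d × EuclideanSpace ℝ d => Fs n p.1 p.2.1 p.2.2) ∧
    (∀ n t x v, |Fs n t x v| ≤ M * exp (-((β₀ - lam * max 0 (min t T)) / 2) * ‖v‖ ^ 2)) ∧
    (∀ n t x v, |Fs (n + 1) t x v - Fs n t x v| ≤
      M * (4 * M * (sphereMeasure : Measure (sphere (0 : EuclideanSpace ℝ d) 1)).real univ *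
          (∫ u : EuclideanSpace ℝ d, (1 + ‖u‖) * exp (-(β₀ / 2 / 2) * ‖u‖ ^ 2)) *
          (T + 2 * sqrt T / sqrt (2 * lam))) ^ n *
        exp (-((β₀ - lam * max 0 (min t T)) / 2) * ‖v‖ ^ 2)) := by
  set S : ℝ := (sphereMeasure : Measure (sphere (0 : EuclideanSpace ℝ d) 1)).real univ with hS
  set I₀ : ℝ := ∫ u : EuclideanSpace ℝ d, (1 + ‖u‖) * exp (-(β₀ / 2 / 2) * ‖u‖ ^ 2) with hI₀
  set ρ : ℝ := T + 2 * sqrt T / sqrt (2 * lam) with hρ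
  have hβ2 : 0 < β₀ / 2 := half_pos hβ₀
  -- continuity and bound, by induction
  have main : ∀ n, (Continuous fun p : ℝ × UnitAddTorus d × EuclideanSpace ℝ d => Fs n p.1 p.2.1 p.2.2) ∧
      (∀ t x v, |Fs n t x v| ≤ M * exp (-((β₀ - lam * max 0 (min t T)) / 2) * ‖v‖ ^ 2)) := by
    intro n
    induction n with
    | zero =>
      refine ⟨?_, fun t x v => ?_⟩
      · have : (fun p : ℝ × UnitAddTorus d × EuclideanSpace ℝ d => Fs 0 p.1 p.2.1 p.2.2) = fun _ => 0 :=
          funext fun p => h0 _ _ _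
        rw [this]; exact continuous_const
      · rw [h0, abs_zero]; positivity
    | succ n ih =>
      have hfun : (fun p : ℝ × UnitAddTorus d × EuclideanSpace ℝ d => Fs (n + 1) p.1 p.2.1 p.2.2) =
          fun p => f₀ (p.2.1 + proj (-(max 0 (min p.1 T) • p.2.2))) p.2.2 +
            ∫ s in (0 : ℝ)..max 0 (min p.1 T),
              collisionOp (Fs n s (p.2.1 + proj ((s - max 0 (min p.1 T)) • p.2.2)))
                (Fs n s (p.2.1 + proj ((s - max 0 (min p.1 T)) • p.2.2))) p.2.2 :=
        funext fun p => hsucc n _ _ _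
      refine ⟨?_, fun t x v => ?_⟩
      · rw [hfun]
        have hQc := continuous_collisionOp_family ih.1 hM hβ2
          (bound_uniform_of_scale hlam.le hT hlamT ih.2)
        exact continuous_picard hf₀c hQc T
      · rw [hsucc]
        refine (picard_bound hK hM hβ₀ hlam hT hlamT hf₀b ih.1 ih.2 t x v).trans ?_
        exact mul_le_mul_of_nonneg_right hball (exp_pos _).le
  refine ⟨fun n => (main n).1, fun n => (main n).2, ?_⟩
  -- geometric bound on the differences
  intro n
  induction n with
  | zero =>
    intro t x v
    rw [h0, sub_zero, pow_zero, mul_one]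
    exact (main 1).2 t x v
  | succ n ih =>
    intro t x v
    have hθN : 0 ≤ M * (4 * M * S * I₀ * ρ) ^ n := by
      have hS0 : 0 ≤ S := measureReal_nonneg
      have hI0 : 0 ≤ I₀ := integral_one_add_norm_mul_exp_nonneg _
      positivity
    rw [hsucc (n + 1), hsucc n]
    refine (picard_contract hM hθN hβ₀ hlam hT hlamT (main (n + 1)).1 (main n).1 (main (n + 1)).2
      (main n).2 ih t x v).trans (le_of_eq ?_)
    ring

/-- **Existence of the fixed point of the Picard map** (GST 2013 Part II Ch. 5, Thm 7 for
`s = 1` closed by the nonlinear equation; Ukai 2001): under the smallness conditions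
`K + 4 M² S I₀ ρ_T ≤ M` and `4 M S I₀ ρ_T ≤ 1/2` there is a jointly continuous `f` with
`|f(t, x, v)| ≤ M e^{-(β₀ - λ t̂)|v|²/2}` and `f = Φ(f)` pointwise (geometric Cauchy sequences,
uniform limit, `Φ` continuous for the weighted distance). [cite: GST2013, Part II Ch. 5 §2 (Thm 7)] -/
theorem exists_fixedPoint_picard {f₀ : UnitAddTorus d → EuclideanSpace ℝ d → ℝ} {K M β₀ lam T : ℝ}
    (hK : 0 ≤ K) (hM : 0 ≤ M) (hβ₀ : 0 < β₀) (hlam : 0 < lam) (hT : 0 ≤ T) (hlamT : lam * T ≤ β₀ / 2)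
    (hf₀c : Continuous (Function.uncurry f₀))
    (hf₀b : ∀ x v, |f₀ x v| ≤ K * exp (-(β₀ / 2) * ‖v‖ ^ 2))
    (hball : K + 4 * M * M * (sphereMeasure : Measure (sphere (0 : EuclideanSpace ℝ d) 1)).real univ *
          (∫ u : EuclideanSpace ℝ d, (1 + ‖u‖) * exp (-(β₀ / 2 / 2) * ‖u‖ ^ 2)) *
          (T + 2 * sqrt T / sqrt (2 * lam)) ≤ M)
    (hθ : 4 * M * (sphereMeasure : Measure (sphere (0 : EuclideanSpace ℝ d) 1)).real univ *
          (∫ u : EuclideanSpace ℝ d, (1 + ‖u‖) * exp (-(β₀ / 2 / 2) * ‖u‖ ^ 2)) *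
          (T + 2 * sqrt T / sqrt (2 * lam)) ≤ 1 / 2) :
    ∃ f : ℝ → UnitAddTorus d → EuclideanSpace ℝ d → ℝ,
      (Continuous fun p : ℝ × UnitAddTorus d × EuclideanSpace ℝ d => f p.1 p.2.1 p.2.2) ∧
      (∀ t x v, |f t x v| ≤ M * exp (-((β₀ - lam * max 0 (min t T)) / 2) * ‖v‖ ^ 2)) ∧
      (∀ t x v, f t x v =
        f₀ (x + proj (-(max 0 (min t T) • v))) v +
          ∫ s in (0 : ℝ)..max 0 (min t T),
            collisionOp (f s (x + proj ((s - max 0 (min t T)) • v)))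
              (f s (x + proj ((s - max 0 (min t T)) • v))) v) := by
  set S : ℝ := (sphereMeasure : Measure (sphere (0 : EuclideanSpace ℝ d) 1)).real univ with hS
  set I₀ : ℝ := ∫ u : EuclideanSpace ℝ d, (1 + ‖u‖) * exp (-(β₀ / 2 / 2) * ‖u‖ ^ 2) with hI₀
  set ρ : ℝ := T + 2 * sqrt T / sqrt (2 * lam) with hρ
  set θ : ℝ := 4 * M * S * I₀ * ρ with hθdef
  have hS0 : 0 ≤ S := measureReal_nonneg
  have hI0 : 0 ≤ I₀ := integral_one_add_norm_mul_exp_nonneg _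
  have hρ0 : 0 ≤ ρ := by positivity
  have hθ0 : 0 ≤ θ := by positivity
  have hθ1 : θ < 1 := by linarith
  -- the iterates
  let Fs : ℕ → ℝ → UnitAddTorus d → EuclideanSpace ℝ d → ℝ := fun n =>
    Nat.rec (fun _ _ _ => (0 : ℝ)) (fun _ G => fun t x v =>
      f₀ (x + proj (-(max 0 (min t T) • v))) v +
        ∫ s in (0 : ℝ)..max 0 (min t T),
          collisionOp (G s (x + proj ((s - max 0 (min t T)) • v)))
            (G s (x + proj ((s - max 0 (min t T)) • v))) v) n
  have h0 : ∀ t x v, Fs 0 t x v = 0 := fun _ _ _ => rfl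
  have hsucc : ∀ n t x v, Fs (n + 1) t x v =
      f₀ (x + proj (-(max 0 (min t T) • v))) v +
        ∫ s in (0 : ℝ)..max 0 (min t T),
          collisionOp (Fs n s (x + proj ((s - max 0 (min t T)) • v)))
            (Fs n s (x + proj ((s - max 0 (min t T)) • v))) v := fun _ _ _ _ => rfl
  obtain ⟨hcont, hbd, hdiff⟩ := picard_iterates hK hM hβ₀ hlam hT hlamT hf₀c hf₀b hball h0 hsucc
  -- pointwise geometric Cauchy sequences
  have hgeo : ∀ t x v n, dist (Fs n t x v) (Fs (n + 1) t x v) ≤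
      (M * exp (-((β₀ - lam * max 0 (min t T)) / 2) * ‖v‖ ^ 2)) * θ ^ n := by
    intro t x v n
    rw [dist_comm, Real.dist_eq]
    have := hdiff n t x v
    calc |Fs (n + 1) t x v - Fs n t x v| ≤ M * θ ^ n * exp (-((β₀ - lam * max 0 (min t T)) / 2) * ‖v‖ ^ 2) := this
      _ = _ := by ring
  have hcauchy : ∀ t x v, CauchySeq fun n => Fs n t x v := fun t x v =>
    cauchySeq_of_le_geometric θ _ hθ1 (hgeo t x v)
  -- the limit
  let f : ℝ → UnitAddTorus d → EuclideanSpace ℝ d → ℝ := fun t x v => limUnder atTop fun n => Fs n t x v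
  have hlim : ∀ t x v, Tendsto (fun n => Fs n t x v) atTop (𝓝 (f t x v)) := fun t x v =>
    tendsto_nhds_limUnder (cauchySeq_tendsto_of_complete (hcauchy t x v))
  have hweight_le_one : ∀ t (v : EuclideanSpace ℝ d), exp (-((β₀ - lam * max 0 (min t T)) / 2) * ‖v‖ ^ 2) ≤ 1 := by
    intro t v
    have hc := clamp_nonneg_le hT t
    rw [exp_le_one_iff]
    have : 0 ≤ β₀ - lam * max 0 (min t T) := by nlinarith [hc.2, hlam.le]
    nlinarith [sq_nonneg ‖v‖]
  have hdist : ∀ n t x v, |Fs n t x v - f t x v| ≤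
      2 * M * θ ^ n * exp (-((β₀ - lam * max 0 (min t T)) / 2) * ‖v‖ ^ 2) := by
    intro n t x v
    have h := dist_le_of_le_geometric_of_tendsto θ _ hθ1 (hgeo t x v) (hlim t x v) n
    rw [Real.dist_eq] at h
    refine h.trans ?_
    rw [div_le_iff₀ (by linarith)]
    have he := (exp_pos (-((β₀ - lam * max 0 (min t T)) / 2) * ‖v‖ ^ 2)).le
    have : 0 ≤ M * exp (-((β₀ - lam * max 0 (min t T)) / 2) * ‖v‖ ^ 2) * θ ^ n := by positivity
    nlinarith
  have hpow : Tendsto (fun n : ℕ => 2 * M * θ ^ n) atTop (𝓝 0) := by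
    simpa using (tendsto_pow_atTop_nhds_zero_of_lt_one hθ0 hθ1).const_mul (2 * M)
  -- joint continuity of the limit (uniform convergence)
  have hfc : Continuous fun p : ℝ × UnitAddTorus d × EuclideanSpace ℝ d => f p.1 p.2.1 p.2.2 := by
    have hunif : TendstoUniformly (fun n (p : ℝ × UnitAddTorus d × EuclideanSpace ℝ d) => Fs n p.1 p.2.1 p.2.2)
        (fun p => f p.1 p.2.1 p.2.2) atTop := by
      rw [Metric.tendstoUniformly_iff]
      intro ε hε
      filter_upwards [hpow.eventually_lt_const hε] with n hn p
      rw [dist_comm, Real.dist_eq]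
      refine lt_of_le_of_lt ((hdist n p.1 p.2.1 p.2.2).trans ?_) hn
      have : 0 ≤ 2 * M * θ ^ n := by positivity
      simpa using mul_le_mul_of_nonneg_left (hweight_le_one p.1 p.2.2) this
    exact hunif.continuous (Eventually.of_forall hcont).frequently
  -- the bound passes to the limit
  have hfb : ∀ t x v, |f t x v| ≤ M * exp (-((β₀ - lam * max 0 (min t T)) / 2) * ‖v‖ ^ 2) :=
    fun t x v => le_of_tendsto' ((continuous_abs.tendsto _).comp (hlim t x v)) fun n => hbd n t x v
  refine ⟨f, hfc, hfb, fun t x v => ?_⟩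
  -- the fixed-point equation: both `F_{n+1}(p) → f(p)` and `F_{n+1}(p) = Φ(F_n)(p) → Φ(f)(p)`
  have h1 : Tendsto (fun n => Fs (n + 1) t x v) atTop (𝓝 (f t x v)) :=
    (hlim t x v).comp (tendsto_add_atTop_nat 1)
  have h2 : Tendsto (fun n => Fs (n + 1) t x v) atTop (𝓝 (f₀ (x + proj (-(max 0 (min t T) • v))) v +
      ∫ s in (0 : ℝ)..max 0 (min t T),
        collisionOp (f s (x + proj ((s - max 0 (min t T)) • v)))
          (f s (x + proj ((s - max 0 (min t T)) • v))) v)) := by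
    rw [tendsto_iff_dist_tendsto_zero]
    have hb : ∀ n, dist (Fs (n + 1) t x v) (f₀ (x + proj (-(max 0 (min t T) • v))) v +
        ∫ s in (0 : ℝ)..max 0 (min t T),
          collisionOp (f s (x + proj ((s - max 0 (min t T)) • v)))
            (f s (x + proj ((s - max 0 (min t T)) • v))) v) ≤ θ * (2 * M * θ ^ n) := by
      intro n
      rw [Real.dist_eq, hsucc]
      have hN : 0 ≤ 2 * M * θ ^ n := by positivity
      refine (picard_contract hM hN hβ₀ hlam hT hlamT (hcont n) hfc (hbd n) hfb (hdist n) t x v).trans ?_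
      change θ * (2 * M * θ ^ n) * exp (-((β₀ - lam * max 0 (min t T)) / 2) * ‖v‖ ^ 2) ≤ θ * (2 * M * θ ^ n)
      have := mul_le_mul_of_nonneg_left (hweight_le_one t v) (mul_nonneg hθ0 hN)
      simpa using this
    refine squeeze_zero (fun n => dist_nonneg) hb ?_
    simpa using hpow.const_mul θ
  exact tendsto_nhds_unique h1 h2

/-- **The fixed point is a mild solution in Duhamel form along the torus characteristics**:
`f(0) = f₀` and, for `t ∈ [0, T]`,
`f(t, x + t v, v) = f₀(x, v) + ∫₀ᵗ Q(f(s, x + s v, ·))(v) ds` (substitute `x ↦ x + t v` in the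
fixed-point equation; additivity of the torus translations). [folklore] -/
theorem duhamel_of_fixedPoint {f : ℝ → UnitAddTorus d → EuclideanSpace ℝ d → ℝ}
    {f₀ : UnitAddTorus d → EuclideanSpace ℝ d → ℝ} {T : ℝ}
    (hfix : ∀ t x v, f t x v =
      f₀ (x + proj (-(max 0 (min t T) • v))) v +
        ∫ s in (0 : ℝ)..max 0 (min t T),
          collisionOp (f s (x + proj ((s - max 0 (min t T)) • v)))
            (f s (x + proj ((s - max 0 (min t T)) • v))) v) :
    (∀ x v, f 0 x v = f₀ x v) ∧
    (∀ t ∈ Icc 0 T, ∀ x v, f t (x + proj (t • v)) v =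
      f₀ x v + ∫ s in (0 : ℝ)..t, collisionOp (f s (x + proj (s • v))) (f s (x + proj (s • v))) v) := by
  constructor
  · intro x v
    rw [hfix]
    simp [proj_zero]
  · intro t ht x v
    rw [hfix, clamp_eq_self ht.1 ht.2, translate_neg]
    congr 1
    refine intervalIntegral.integral_congr fun s _ => ?_
    simp only [translate_translate, add_sub_cancel]

/-- **The source term of the positivity argument** (Kaniel–Shinbrot sign structure in the
scale): if `|f(s)| ≤ M e^{-β(s)|u|²/2}` and `-f(s) ≤ N e^{-β(s)|u|²/2}` on `[0, T]`,
`β(s) = β₀ - λ s`, then along any point `y` of the torus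
`Q(f(s,y,·))(v) + L(f(s,y,·)⁺)(v) f(s,y,v) ≥ -3 M N S I₀ (1 + |v|) e^{-β(s)|v|²/2}`. [folklore] -/
theorem source_lower_bound {f : ℝ → UnitAddTorus d → EuclideanSpace ℝ d → ℝ} {M N β₀ lam T : ℝ}
    (hM : 0 ≤ M) (hN : 0 ≤ N) (hβ₀ : 0 < β₀) (hlam : 0 < lam) (hlamT : lam * T ≤ β₀ / 2)
    (hfc : Continuous fun p : ℝ × UnitAddTorus d × EuclideanSpace ℝ d => f p.1 p.2.1 p.2.2)
    (hfb : ∀ s x u, |f s x u| ≤ M * exp (-((β₀ - lam * max 0 (min s T)) / 2) * ‖u‖ ^ 2))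
    (hneg : ∀ s ∈ Icc 0 T, ∀ y u, -f s y u ≤ N * exp (-((β₀ - lam * s) / 2) * ‖u‖ ^ 2))
    {s : ℝ} (hs : s ∈ Icc 0 T) (y : UnitAddTorus d) (v : EuclideanSpace ℝ d) :
    -(3 * M * N * (sphereMeasure : Measure (sphere (0 : EuclideanSpace ℝ d) 1)).real univ *
        (∫ u : EuclideanSpace ℝ d, (1 + ‖u‖) * exp (-(β₀ / 2 / 2) * ‖u‖ ^ 2)) *
        ((1 + ‖v‖) * exp (-((β₀ - lam * s) / 2) * ‖v‖ ^ 2))) ≤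
      collisionOp (f s y) (f s y) v +
        (∫ w, ∫ ω, hardSphereKernel (v, w) ω * max (f s y w) 0
          ∂(sphereMeasure : Measure (sphere (0 : EuclideanSpace ℝ d) 1))) * f s y v := by
  set S : ℝ := (sphereMeasure : Measure (sphere (0 : EuclideanSpace ℝ d) 1)).real univ with hS
  set I₀ : ℝ := ∫ u : EuclideanSpace ℝ d, (1 + ‖u‖) * exp (-(β₀ / 2 / 2) * ‖u‖ ^ 2) with hI₀
  have hS0 : 0 ≤ S := measureReal_nonneg
  have hcs : max 0 (min s T) = s := clamp_eq_self hs.1 hs.2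
  have hβs : 0 < β₀ - lam * s := by nlinarith [hs.2, hlam.le]
  have hβs' : β₀ / 2 ≤ β₀ - lam * s := by nlinarith [hs.2, hlam.le]
  have hgc : Continuous (f s y) :=
    hfc.comp (f := fun u : EuclideanSpace ℝ d => (s, y, u)) (by fun_prop)
  have hgb : ∀ u, |f s y u| ≤ M * exp (-((β₀ - lam * s) / 2) * ‖u‖ ^ 2) :=
    fun u => by have := hfb s y u; rwa [hcs] at this
  have h := neg_collisionOp_add_mul_lossPos_le hgc hM hN hβs hgb (hneg s hs y) v
  have hI : ∫ u : EuclideanSpace ℝ d, (1 + ‖u‖) * exp (-((β₀ - lam * s) / 2) * ‖u‖ ^ 2) ≤ I₀ :=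
    integral_one_add_norm_mul_exp_mono (half_pos hβ₀) hβs'
  have hψ0 : 0 ≤ (1 + ‖v‖) * exp (-((β₀ - lam * s) / 2) * ‖v‖ ^ 2) := by positivity
  have hle : 3 * M * N * S * (∫ u : EuclideanSpace ℝ d, (1 + ‖u‖) * exp (-((β₀ - lam * s) / 2) * ‖u‖ ^ 2)) *
      ((1 + ‖v‖) * exp (-((β₀ - lam * s) / 2) * ‖v‖ ^ 2)) ≤
        3 * M * N * S * I₀ * ((1 + ‖v‖) * exp (-((β₀ - lam * s) / 2) * ‖v‖ ^ 2)) :=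
    mul_le_mul_of_nonneg_right (mul_le_mul_of_nonneg_left hI (by positivity)) hψ0
  rw [mul_comm (∫ w, ∫ ω, hardSphereKernel (v, w) ω * max (f s y w) 0
    ∂(sphereMeasure : Measure (sphere (0 : EuclideanSpace ℝ d) 1))) (f s y v)]
  linarith

/-- **Ukai's bound for the integrated source term**: for `t ∈ [0, T]`,
`∫₀ᵗ A (1 + |v|) e^{-(β₀ - λ ŝ)|v|²/2} ds ≤ A ρ_T e^{-(β₀ - λ t)|v|²/2}`. [cite: GST2013, Part II Ch. 5 §3 (Lemma of Ukai)] -/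
theorem integral_source_le {A β₀ lam T : ℝ} (hA : 0 ≤ A) (hlam : 0 < lam) {t : ℝ} (ht : t ∈ Icc 0 T)
    (v : EuclideanSpace ℝ d) :
    ∫ s in (0 : ℝ)..t, A * ((1 + ‖v‖) * exp (-((β₀ - lam * max 0 (min s T)) / 2) * ‖v‖ ^ 2)) ≤
      A * (T + 2 * sqrt T / sqrt (2 * lam)) * exp (-((β₀ - lam * t) / 2) * ‖v‖ ^ 2) := by
  have h := abs_integral_le_of_scale
    (q := fun s => A * ((1 + ‖v‖) * exp (-((β₀ - lam * max 0 (min s T)) / 2) * ‖v‖ ^ 2)))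
    (A := A) (lam := lam) (β₁ := β₀) (t₁ := 0) (t := t) (r := ‖v‖) hA hlam ht.1 (fun s hs => by
      have hs' : s ∈ Icc 0 T := ⟨hs.1.le, hs.2.le.trans ht.2⟩
      have h0 : 0 ≤ A * ((1 + ‖v‖) * exp (-((β₀ - lam * max 0 (min s T)) / 2) * ‖v‖ ^ 2)) := by
        positivity
      rw [abs_of_nonneg h0]
      simp only [clamp_eq_self hs'.1 hs'.2, sub_zero]
      exact le_refl _)
  simp only [sub_zero] at h
  refine (le_abs_self _).trans (h.trans ?_)
  have hsq : sqrt t ≤ sqrt T := sqrt_le_sqrt ht.2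
  have hρt : t + 2 * sqrt t / sqrt (2 * lam) ≤ T + 2 * sqrt T / sqrt (2 * lam) := by
    have : 2 * sqrt t / sqrt (2 * lam) ≤ 2 * sqrt T / sqrt (2 * lam) :=
      div_le_div_of_nonneg_right (by linarith) (sqrt_nonneg _)
    linarith [ht.2]
  have hA' : 0 ≤ A * exp (-((β₀ - lam * t) / 2) * ‖v‖ ^ 2) := by positivity
  calc A * exp (-((β₀ - lam * t) / 2) * ‖v‖ ^ 2) * (t + 2 * sqrt t / sqrt (2 * lam))
      ≤ A * exp (-((β₀ - lam * t) / 2) * ‖v‖ ^ 2) * (T + 2 * sqrt T / sqrt (2 * lam)) :=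
        mul_le_mul_of_nonneg_left hρt hA'
    _ = A * (T + 2 * sqrt T / sqrt (2 * lam)) * exp (-((β₀ - lam * t) / 2) * ‖v‖ ^ 2) := by ring

/-- **One step of the positivity bootstrap**: if `-f ≤ N e^{-β(s)|u|²/2}` on `[0, T]` then
`-f ≤ (3 M S I₀ ρ_T) N e^{-β(t)|v|²/2}` on `[0, T]` (the comparison lemma
`ge_neg_integral_of_duhamel_ineq` along the characteristic through `(t, y, v)` with absorption
`L(f⁺) ≥ 0` and source bounded by `source_lower_bound`, then `integral_source_le`). [folklore] -/
theorem negPart_step {f : ℝ → UnitAddTorus d → EuclideanSpace ℝ d → ℝ}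
    {f₀ : UnitAddTorus d → EuclideanSpace ℝ d → ℝ} {M N β₀ lam T : ℝ}
    (hM : 0 ≤ M) (hN : 0 ≤ N) (hβ₀ : 0 < β₀) (hlam : 0 < lam) (hT : 0 ≤ T) (hlamT : lam * T ≤ β₀ / 2)
    (hf₀nn : ∀ x v, 0 ≤ f₀ x v)
    (hfc : Continuous fun p : ℝ × UnitAddTorus d × EuclideanSpace ℝ d => f p.1 p.2.1 p.2.2)
    (hfb : ∀ s x u, |f s x u| ≤ M * exp (-((β₀ - lam * max 0 (min s T)) / 2) * ‖u‖ ^ 2))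
    (hinit : ∀ x v, f 0 x v = f₀ x v)
    (hduh : ∀ t ∈ Icc 0 T, ∀ x v, f t (x + proj (t • v)) v =
      f₀ x v + ∫ s in (0 : ℝ)..t, collisionOp (f s (x + proj (s • v))) (f s (x + proj (s • v))) v)
    (hneg : ∀ s ∈ Icc 0 T, ∀ y u, -f s y u ≤ N * exp (-((β₀ - lam * s) / 2) * ‖u‖ ^ 2))
    {t : ℝ} (ht : t ∈ Icc 0 T) (y : UnitAddTorus d) (v : EuclideanSpace ℝ d) :
    -f t y v ≤ (3 * M * (sphereMeasure : Measure (sphere (0 : EuclideanSpace ℝ d) 1)).real univ *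
        (∫ u : EuclideanSpace ℝ d, (1 + ‖u‖) * exp (-(β₀ / 2 / 2) * ‖u‖ ^ 2)) *
        (T + 2 * sqrt T / sqrt (2 * lam))) * N * exp (-((β₀ - lam * t) / 2) * ‖v‖ ^ 2) := by
  have hS0 : 0 ≤ (sphereMeasure : Measure (sphere (0 : EuclideanSpace ℝ d) 1)).real univ :=
    measureReal_nonneg
  have hI0 : 0 ≤ ∫ u : EuclideanSpace ℝ d, (1 + ‖u‖) * exp (-(β₀ / 2 / 2) * ‖u‖ ^ 2) :=
    integral_one_add_norm_mul_exp_nonneg _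
  have hβ2 : 0 < β₀ / 2 := half_pos hβ₀
  have hfu := bound_uniform_of_scale hlam.le hT hlamT hfb
  have hQc := continuous_collisionOp_family hfc hM hβ2 hfu
  have hLc := continuous_lossPos_family hfc hM hβ2 hfu
  -- the characteristic through `(t, y, v)` starts at `x = y - t v`
  obtain ⟨x, hxy⟩ : ∃ x : UnitAddTorus d, x + proj (t • v) = y :=
    ⟨y + proj (-(t • v)), by rw [proj_neg, neg_add_cancel_right]⟩
  have hpath : Continuous fun s : ℝ => (s, x + proj (s • v), v) := by
    refine Continuous.prodMk continuous_id (Continuous.prodMk ?_ continuous_const)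
    exact continuous_const.add ((continuous_proj (d := d)).comp (continuous_id.smul continuous_const))
  -- the data of the comparison lemma along this characteristic
  have hqc : Continuous fun s : ℝ => collisionOp (f s (x + proj (s • v))) (f s (x + proj (s • v))) v := by
    have h := hQc.comp' hpath
    exact h
  have hℓc : Continuous fun s : ℝ => ∫ w, ∫ ω, hardSphereKernel (v, w) ω * max (f s (x + proj (s • v)) w) 0
      ∂(sphereMeasure : Measure (sphere (0 : EuclideanSpace ℝ d) 1)) := by
    have h := hLc.comp' hpath
    exact h
  have hrc : Continuous fun s : ℝ => 3 * M * N *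
      (sphereMeasure : Measure (sphere (0 : EuclideanSpace ℝ d) 1)).real univ *
      (∫ u : EuclideanSpace ℝ d, (1 + ‖u‖) * exp (-(β₀ / 2 / 2) * ‖u‖ ^ 2)) *
      ((1 + ‖v‖) * exp (-((β₀ - lam * max 0 (min s T)) / 2) * ‖v‖ ^ 2)) := by
    have hc : Continuous fun s : ℝ => max 0 (min s T) := (continuous_const.max (continuous_id.min continuous_const) :
      Continuous fun t : ℝ => max 0 (min t T))
    have h1 : Continuous fun s : ℝ => exp (-((β₀ - lam * max 0 (min s T)) / 2) * ‖v‖ ^ 2) :=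
      continuous_exp.comp (((continuous_const.sub (continuous_const.mul hc)).div_const 2).neg.mul
        continuous_const)
    exact continuous_const.mul (continuous_const.mul h1)
  have hφ0 : f 0 (x + proj ((0 : ℝ) • v)) v = f₀ x v := by
    rw [zero_smul, proj_zero, add_zero]; exact hinit x v
  have hφduh : ∀ s ∈ Icc 0 T, f s (x + proj (s • v)) v = f 0 (x + proj ((0 : ℝ) • v)) v +
      ∫ u in (0 : ℝ)..s, collisionOp (f u (x + proj (u • v))) (f u (x + proj (u • v))) v := by
    intro s hs
    rw [hφ0]
    exact hduh s hs x v
  have hsrc : ∀ s ∈ Icc 0 T, -(3 * M * N *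
      (sphereMeasure : Measure (sphere (0 : EuclideanSpace ℝ d) 1)).real univ *
      (∫ u : EuclideanSpace ℝ d, (1 + ‖u‖) * exp (-(β₀ / 2 / 2) * ‖u‖ ^ 2)) *
      ((1 + ‖v‖) * exp (-((β₀ - lam * max 0 (min s T)) / 2) * ‖v‖ ^ 2))) ≤
      collisionOp (f s (x + proj (s • v))) (f s (x + proj (s • v))) v +
        (∫ w, ∫ ω, hardSphereKernel (v, w) ω * max (f s (x + proj (s • v)) w) 0
          ∂(sphereMeasure : Measure (sphere (0 : EuclideanSpace ℝ d) 1))) * f s (x + proj (s • v)) v := by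
    intro s hs
    rw [clamp_eq_self hs.1 hs.2]
    exact source_lower_bound hM hN hβ₀ hlam hlamT hfc hfb hneg hs (x + proj (s • v)) v
  have hcomp := ge_neg_integral_of_duhamel_ineq (T := T)
    (φ := fun s => f s (x + proj (s • v)) v) hqc hℓc hrc (fun s => lossPos_nonneg _ _)
    (fun s => by positivity) hφduh hsrc (by rw [hφ0]; exact hf₀nn x v) t ht
  have hint := integral_source_le (β₀ := β₀) (T := T)
    (A := 3 * M * N * (sphereMeasure : Measure (sphere (0 : EuclideanSpace ℝ d) 1)).real univ *
      (∫ u : EuclideanSpace ℝ d, (1 + ‖u‖) * exp (-(β₀ / 2 / 2) * ‖u‖ ^ 2)))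
    (by positivity) hlam ht v
  rw [← hxy]
  refine (neg_le.2 hcomp).trans ?_
  refine hint.trans (le_of_eq ?_)
  ring

/-- **Positivity of the fixed point** (a-posteriori; the sign structure `Q = Q⁺ - f L(f)` of
Kaniel–Shinbrot in Lanford's class): iterating `negPart_step`, the weighted bound of the
negative part of `f` is `≤ M θ'ⁿ` for every `n` with `θ' = 3 M S I₀ ρ_T < 1`, hence `f ≥ 0`
on `[0, T]`. [folklore] -/
theorem nonneg_of_fixedPoint {f : ℝ → UnitAddTorus d → EuclideanSpace ℝ d → ℝ}
    {f₀ : UnitAddTorus d → EuclideanSpace ℝ d → ℝ} {M β₀ lam T : ℝ}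
    (hM : 0 ≤ M) (hβ₀ : 0 < β₀) (hlam : 0 < lam) (hT : 0 ≤ T) (hlamT : lam * T ≤ β₀ / 2)
    (hf₀nn : ∀ x v, 0 ≤ f₀ x v)
    (hfc : Continuous fun p : ℝ × UnitAddTorus d × EuclideanSpace ℝ d => f p.1 p.2.1 p.2.2)
    (hfb : ∀ s x u, |f s x u| ≤ M * exp (-((β₀ - lam * max 0 (min s T)) / 2) * ‖u‖ ^ 2))
    (hinit : ∀ x v, f 0 x v = f₀ x v)
    (hduh : ∀ t ∈ Icc 0 T, ∀ x v, f t (x + proj (t • v)) v =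
      f₀ x v + ∫ s in (0 : ℝ)..t, collisionOp (f s (x + proj (s • v))) (f s (x + proj (s • v))) v)
    (hθ' : 3 * M * (sphereMeasure : Measure (sphere (0 : EuclideanSpace ℝ d) 1)).real univ *
          (∫ u : EuclideanSpace ℝ d, (1 + ‖u‖) * exp (-(β₀ / 2 / 2) * ‖u‖ ^ 2)) *
          (T + 2 * sqrt T / sqrt (2 * lam)) < 1) :
    ∀ t ∈ Icc 0 T, ∀ x v, 0 ≤ f t x v := by
  set θ' : ℝ := 3 * M * (sphereMeasure : Measure (sphere (0 : EuclideanSpace ℝ d) 1)).real univ *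
    (∫ u : EuclideanSpace ℝ d, (1 + ‖u‖) * exp (-(β₀ / 2 / 2) * ‖u‖ ^ 2)) *
    (T + 2 * sqrt T / sqrt (2 * lam)) with hθdef
  have hS0 : 0 ≤ (sphereMeasure : Measure (sphere (0 : EuclideanSpace ℝ d) 1)).real univ := measureReal_nonneg
  have hI0 : 0 ≤ ∫ u : EuclideanSpace ℝ d, (1 + ‖u‖) * exp (-(β₀ / 2 / 2) * ‖u‖ ^ 2) :=
    integral_one_add_norm_mul_exp_nonneg _
  have hθ0 : 0 ≤ θ' := by positivity
  -- the bootstrap on the negative part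
  have P : ∀ n : ℕ, ∀ t ∈ Icc 0 T, ∀ y v, -f t y v ≤ M * θ' ^ n * exp (-((β₀ - lam * t) / 2) * ‖v‖ ^ 2) := by
    intro n
    induction n with
    | zero =>
      intro t ht y v
      have h := (neg_le_abs (f t y v)).trans (hfb t y v)
      rwa [clamp_eq_self ht.1 ht.2, pow_zero, mul_one] at *
    | succ n ih =>
      intro t ht y v
      have hN : 0 ≤ M * θ' ^ n := by positivity
      refine (negPart_step hM hN hβ₀ hlam hT hlamT hf₀nn hfc hfb hinit hduh ih ht y v).trans (le_of_eq ?_)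
      rw [hθdef]
      ring
  -- let `n → ∞`
  intro t ht y v
  have hlim : Tendsto (fun n : ℕ => M * θ' ^ n * exp (-((β₀ - lam * t) / 2) * ‖v‖ ^ 2)) atTop (𝓝 0) := by
    have := ((tendsto_pow_atTop_nhds_zero_of_lt_one hθ0 hθ').const_mul M).mul_const
      (exp (-((β₀ - lam * t) / 2) * ‖v‖ ^ 2))
    simpa using this
  have : -f t y v ≤ 0 := ge_of_tendsto' hlim fun n => P n t ht y v
  linarith

end FixedPoint

/-! ## Existence of a mild solution in Lanford's class -/

section Existence

/-- **Existence half of `ukai_lanford_lwp`** (GST 2013, Part I Ch. 2 §3.1 Thm 1, hard-sphere /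
torus version proved by the scale method of Part II Ch. 5): for `β₀ > 0`, `K > 0` there is an
explicit `T = T(β₀, K, d) > 0` — namely `T = (1 + 16 K |S^{d-1}| I₀ (1 + 2/√(β₀/2)))^{-2}`,
`I₀ = ∫ (1 + |u|) e^{-β₀|u|²/8} du`, with `λ = β₀/4` — such that every continuous `f₀ ≥ 0` with
`‖f₀‖_{β₀} ≤ K` is the initial value of a mild solution of the hard-sphere Boltzmann equation on
`[0, T] × T^d` which is continuous in time with values in `X_{β₀/2}`. [cite: GST2013, Part I Ch. 2 §3.1 Thm 1; Part II Ch. 5 Thm 7] -/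
theorem exists_mildSolution {β₀ K : ℝ} (hβ₀ : 0 < β₀) (hK : 0 < K) :
    ∃ T > (0 : ℝ), ∀ f₀ : UnitAddTorus d → EuclideanSpace ℝ d → ℝ, (∀ x v, 0 ≤ f₀ x v) →
      Literature.Analysis.FluidPDE.MemLanford β₀ f₀ →
      Literature.Analysis.FluidPDE.eGaussSupNorm β₀ f₀ ≤ ENNReal.ofReal K →
      ∃ f : ℝ → UnitAddTorus d → EuclideanSpace ℝ d → ℝ,
        Literature.Analysis.FluidPDE.ContinuousInLanfordOn (Icc 0 T) (β₀ / 2) f ∧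
        Literature.Analysis.FluidPDE.IsMildBoltzmannSolutionOn T
          (Literature.Analysis.FluidPDE.Torus.geometry d) hardSphereKernel f ∧ f 0 = f₀ := by
  set S : ℝ := (sphereMeasure : Measure (sphere (0 : EuclideanSpace ℝ d) 1)).real univ with hS
  set I₀ : ℝ := ∫ u : EuclideanSpace ℝ d, (1 + ‖u‖) * exp (-(β₀ / 2 / 2) * ‖u‖ ^ 2) with hI₀
  have hS0 : 0 ≤ S := measureReal_nonneg
  have hI0 : 0 ≤ I₀ := integral_one_add_norm_mul_exp_nonneg _
  set lam : ℝ := β₀ / 4 with hlam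
  have hlam0 : 0 < lam := by positivity
  set a : ℝ := 1 + 2 / sqrt (β₀ / 2) with ha
  have ha0 : 0 < a := by positivity
  set c : ℝ := 16 * K * S * I₀ * a with hc
  have hc0 : 0 ≤ c := by positivity
  set T : ℝ := (1 / (1 + c)) ^ 2 with hT
  have hT0 : 0 < T := by positivity
  have hsqT : sqrt T = 1 / (1 + c) := by rw [hT, sqrt_sq (by positivity)]
  have hsqT1 : sqrt T ≤ 1 := by
    rw [hsqT, div_le_one (by positivity)]; linarith
  have hTsq : T ≤ sqrt T :=
    calc T = sqrt T * sqrt T := (Real.mul_self_sqrt hT0.le).symm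
      _ ≤ sqrt T * 1 := mul_le_mul_of_nonneg_left hsqT1 (sqrt_nonneg _)
      _ = sqrt T := mul_one _
  have hT1 : T ≤ 1 := hTsq.trans hsqT1
  have hlamT : lam * T ≤ β₀ / 2 := by rw [hlam]; nlinarith
  set ρ : ℝ := T + 2 * sqrt T / sqrt (2 * lam) with hρ
  have h2lam : 2 * lam = β₀ / 2 := by rw [hlam]; ring
  have hρle : ρ ≤ sqrt T * a := by
    rw [hρ, ha, h2lam, mul_add, mul_one]
    have : 2 * sqrt T / sqrt (β₀ / 2) = sqrt T * (2 / sqrt (β₀ / 2)) := by ring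
    rw [this]; linarith
  have hsmall : 16 * K * S * I₀ * ρ ≤ 1 :=
    calc 16 * K * S * I₀ * ρ ≤ 16 * K * S * I₀ * (sqrt T * a) :=
          mul_le_mul_of_nonneg_left hρle (by positivity)
      _ = c * sqrt T := by rw [hc]; ring
      _ = c / (1 + c) := by rw [hsqT]; ring
      _ ≤ 1 := by rw [div_le_one (by positivity)]; linarith
  have hprod : 0 ≤ K * S * I₀ * ρ := by
    have hρ0 : 0 ≤ ρ := by rw [hρ]; positivity
    positivity
  have hball : K + 4 * (2 * K) * (2 * K) * S * I₀ * ρ ≤ 2 * K := by nlinarith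
  have hθ : 4 * (2 * K) * S * I₀ * ρ ≤ 1 / 2 := by nlinarith
  have hθ' : 3 * (2 * K) * S * I₀ * ρ < 1 := by nlinarith
  refine ⟨T, hT0, fun f₀ hf₀nn hf₀L hf₀K => ?_⟩
  have hf₀c : Continuous (Function.uncurry f₀) := hf₀L.1
  have hf₀b : ∀ x v, |f₀ x v| ≤ K * exp (-(β₀ / 2) * ‖v‖ ^ 2) :=
    abs_le_of_eGaussSupNorm_le hK.le hf₀K
  have hM : (0 : ℝ) ≤ 2 * K := by positivity
  obtain ⟨f, hfc, hfb, hfix⟩ := exists_fixedPoint_picard (M := 2 * K) hK.le hM hβ₀ hlam0 hT0.le hlamT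
    hf₀c hf₀b hball hθ
  obtain ⟨hinit, hduh⟩ := duhamel_of_fixedPoint hfix
  have hnn := nonneg_of_fixedPoint hM hβ₀ hlam0 hT0.le hlamT hf₀nn hfc hfb hinit hduh hθ'
  -- uniform bound in `X_{3β₀/4}` on `[0, T]`
  have hfu : ∀ t ∈ Icc 0 T, ∀ x v, |f t x v| ≤ 2 * K * exp (-(3 * β₀ / 4 / 2) * ‖v‖ ^ 2) := by
    intro t ht x v
    refine (hfb t x v).trans (mul_le_mul_of_nonneg_left (exp_weight_mono ?_ ‖v‖) hM)
    rw [clamp_eq_self ht.1 ht.2, hlam]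
    nlinarith [ht.1, ht.2]
  have hQc : Continuous fun p : ℝ × UnitAddTorus d × EuclideanSpace ℝ d =>
      collisionOp (f p.1 p.2.1) (f p.1 p.2.1) p.2.2 :=
    continuous_collisionOp_family hfc hM (half_pos hβ₀)
      (bound_uniform_of_scale hlam0.le hT0.le hlamT hfb)
  have halong : ∀ (x : UnitAddTorus d) (v : EuclideanSpace ℝ d), (fun τ =>
      Literature.Analysis.FluidPDE.alongFlow (Literature.Analysis.FluidPDE.Torus.geometry d)
        (Literature.Analysis.FluidPDE.collisionTerm hardSphereKernel f) τ x v) =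
      fun τ => collisionOp (f τ (x + proj (τ • v))) (f τ (x + proj (τ • v))) v := by
    intro x v
    funext τ
    simp only [Literature.Analysis.FluidPDE.alongFlow, Literature.Analysis.FluidPDE.collisionTerm,
      Literature.Analysis.FluidPDE.Torus.geometry_translate,
      Literature.Analysis.FluidPDE.collisionOpWith_hardSphereKernel]
  refine ⟨f, ⟨fun t ht => ?_, ?_⟩, ⟨hnn, fun x v t _ => ?_, fun x v t ht => ?_⟩,
    funext fun x => funext fun v => hinit x v⟩
  · exact memLanford_of_bound (β₁ := 3 * β₀ / 4) (C := 2 * K) (by linarith) hM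
      (hfc.comp (by fun_prop : Continuous fun q : UnitAddTorus d × EuclideanSpace ℝ d => (t, q.1, q.2)))
      (fun x v => hfu t ht x v)
  · exact tendsto_eGaussSupNorm_sub (Y := UnitAddTorus d) hfc (β₁ := 3 * β₀ / 4) (β' := β₀ / 2)
      (C := 2 * K) (by linarith) (by linarith [hβ₀.le]) hM hfu
  · have hpath : Continuous fun τ : ℝ => (τ, x + proj (τ • v), v) := by
      refine Continuous.prodMk continuous_id (Continuous.prodMk ?_ continuous_const)
      exact continuous_const.add ((continuous_proj (d := d)).comp (continuous_id.smul continuous_const))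
    rw [halong x v]
    exact (hQc.comp' hpath).intervalIntegrable 0 t
  · rw [halong x v]
    simp only [Literature.Analysis.FluidPDE.alongFlow, Literature.Analysis.FluidPDE.Torus.geometry_translate]
    rw [hduh t ht x v, hinit x v]

end Existence

end

end UkaiLanford

end Literature.MathematicalPhysics.KineticTheory
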